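import Summits.QuantumFields.BalabanUV.Beta.EriceFlowEnclosureB12AsPrintedPointwiseFadingWitness
import Summits.QuantumFields.BalabanUV.Beta.EriceFlowEnclosureB12AsPrintedPointwiseFadingIff
import Literature.MathematicalPhysics.QuantumFieldTheory.Balaban1983to89.Beta.AveragedAFCarrier

/-!
# Beta / EriceFlowEnclosureB12AsPrintedPointwiseFadingAvgAF — WHAT (0.31) FORCES POINTWISE, part 6d: SOCKET e3's CARRIER.  The averaged-AF carrier `BetaAvgAFH s D γ` of the CAP road
# (`Beta.AveragedAFCarrier`, the letter R4-CAP's certified slice instantiates for B3's END socket e3: window sums `Σ_{j∈[k,n)} β_{j+1}(g₀,…,g_j) ≥ s(n − k) − D` along EVERY box history) is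
# NECESSARY for [I] Theorem 2 with g-uniform constants under node U2's coupling-chart fading-memory moduli (slope β ln L − Cδ∕(1 − θ) > 0, defect 0) — and NOT without them: part 4's
# two-coupling toy (g-uniform (0.31), Theorem 2, uniqueness, (U)(C)(264)`hrg`) violates `BetaAvgAFH s D γ` for EVERY slope s ≥ 0, EVERY defect D and EVERY box γ (β-flow team, prover 2 =
# lower ∕ positivity side, unit `b2b-balaban-beta-bflow-p2`, gen 43; ROW AP-I × ROW U × crew CAP socket e3; parts 5∕6∕6b∕6c `…PointwiseCover ∕ Fading ∕ FadingWitness ∕ FadingIff`)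

HONEST FRAMING (page 1 of everything the β sub-cell writes): discharging `BetaPertH` makes Bałaban's UV stability UNCONDITIONAL — a
real constructive-QFT result; it is NOT the continuum limit and NOT the Clay problem.  HONEST DEPENDENCY (cell reorg 2026-08-19,
verbatim): «continuum YM on T⁴ ⇐ BetaPertH ∧ nine spine estimates (0/9 proved); BetaPertH ⇐ (D1) ∧ (D4) ∧ CAP+tail; G-an2-4 gates
asym, D1 and NE2/3/4.»  THIS MODULE DISCHARGES NOTHING: bookkeeping from the NAMED FIELDS of `B12BetaAsPrinted` ([Balaban1987RG1] as typed; Theorem 2 STATED WITHOUT PROOF, p. 259)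
and the HYPOTHESIS SHAPES `Beta.AveragedAFCarrier.BetaAvgAFH` (crew CAP's carrier — for Bałaban's (1.22) every instance is a located UNPRINTED input), `T4CouplingMatching.HistLipschitz ∕
FadingMemory` (node U2; NOT printed), under letters displayed as hypotheses on an abstract `Setting S`; the toy family is OURS (part 4).  Nothing of Bałaban's objects is asserted.

WHAT THIS FILE PROVES (0 sorry, 0 def):
§1 **`betaAvgAFH_of_uniformTheorem2_fadingMemory`** (`hTu` + `Definitions` + (U) + `hrg` + `HistLipschitz`∕`FadingMemory` ⟹ ∃ x₁ s > 0, `BetaAvgAFH s 0 x₁ S.β`, via part 6's END and the CAP road's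
   `betaAvgAFH_of_betaLowerH`), **`betaAvgAFH_of_uniformTheorem2_fadingMemory'`** (`StandingHypotheses` form, `hrg` discharged from (U) with b′γ_U² < 1).
§2 (the two-coupling family, hypotheses `hDip`, `hβ`) **`not_betaAvgAFH_hist`** (for every γ > 0, s ≥ 0, D: ¬`BetaAvgAFH s D γ S.β` — the box history with n consecutive increments ½ ending at γ has
   window sum −(n − 1)∕2 over [1, n)).
§3 **`avgAF_loadBearing`** (the def-free two-coupling setting: [I]'s typed content ∧ g-uniform (0.31) ∧ `Theorem2Statement` ∧ uniqueness ∧ (U)(C)(264)`hrg` ∧ ∀ γ s D, ¬`BetaAvgAFH s D γ`),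
   **`not_betaAvgAFH_without_modulus_schema`** (§1 with the moduli deleted — uniqueness kept — is FALSE as a schema, even for slope 0 and any defect).
NOT CLAIMED: any instance of `BetaAvgAFH`, any modulus, sign or bound for Bałaban's β; Theorem 2; `BetaPertH`; continuum; Clay.
-/

namespace Summit.QuantumFields.BalabanUV.Beta.EriceFlowEnclosureB12AsPrintedPointwiseFadingAvgAF

open Real (smoothTransition)
open Literature.MathematicalPhysics.QuantumFieldTheory.Balaban1983to89
open Literature.MathematicalPhysics.QuantumFieldTheory.Balaban1983to89.B12BetaAsPrinted
open Literature.MathematicalPhysics.QuantumFieldTheory.Balaban1983to89.B12CouplingClausesHistory (BetaSmoothInLast264)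
open Literature.MathematicalPhysics.QuantumFieldTheory.Balaban1983to89.FlowStep (prefixOf Box mem_box box_mono BetaContH BetaLowerH BetaUpperH
  BetaSignH BetaAFH RGEqH)
open Literature.MathematicalPhysics.QuantumFieldTheory.Balaban1983to89.T4CouplingMatching (HistLipschitz FadingMemory)
open Literature.MathematicalPhysics.QuantumFieldTheory.Balaban1983to89.Beta.AveragedAFCarrier (BetaAvgAFH betaAvgAFH_of_betaLowerH)
open Summit.QuantumFields.BalabanUV.Beta.EriceFlowEnclosureB12AsPrintedTunedUpper (hrg_of_betaUpperH)
open Summit.QuantumFields.BalabanUV.Beta.EriceFlowEnclosureB12AsPrintedPointwiseDip (dip_center)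
open Summit.QuantumFields.BalabanUV.Beta.EriceFlowEnclosureB12AsPrintedPointwiseHistory (letters_hist uniformTheorem2_not_betaSignH_hist unique_hist)
open Summit.QuantumFields.BalabanUV.Beta.EriceFlowEnclosureB12AsPrintedPointwiseHistoryWitness (histToy_exists)
open Summit.QuantumFields.BalabanUV.Beta.EriceFlowEnclosureB12AsPrintedPointwiseFading (letters_of_uniformTheorem2_fadingMemory)

noncomputable section

variable {S : Setting}

/-! ## §1 Socket e3's carrier is necessary for the g-uniform Theorem 2 under fading memory -/

/-- **THE AVERAGED-AF CARRIER `BetaAvgAFH` (CAP road, socket e3) FROM THE g-UNIFORM THEOREM 2 AND FADING MEMORY.**  `hTu` + the printed `Definitions` + (U) + prover 1's binder `hrg` + node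
U2's `HistLipschitz Λ γ_U S.β` with `FadingMemory C θ Λ` ⟹ some box ]0, x₁] and slope s > 0 with `BetaAvgAFH s 0 x₁ S.β` (defect ZERO): part 6's pointwise letter `BetaLowerH (β ln L − Cδ∕(1 − θ)) δ` at
δ = min(x₁, β ln L(1 − θ)∕(2(C + 1))) summed over the window (`betaAvgAFH_of_betaLowerH`).  So the letter the certified slice instantiates is not only sufficient (the CAP road) but
NECESSARY for the uniform-constant Theorem 2 in this regime. [cite: Balaban1987RG1, Thm 2 (0.31) p.259 with (0.20) p.256 and p.298] -/
theorem betaAvgAFH_of_uniformTheorem2_fadingMemory (hD : Definitions S)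
    (hTu : ∀ m : ℕ, ∃ γ₀ : ℝ, 0 < γ₀ ∧ ∀ γ : ℝ, 0 < γ → γ ≤ γ₀ → ∃ g₁ : ℝ, 0 < g₁ ∧ ∃ β β' : ℝ, 0 < β ∧ β ≤ β' ∧
      ∀ g : ℝ, 0 < g → g ≤ g₁ → ∀ K : ℕ, ∃ g₀ : ℝ, Step.InInterval γ K (S.cpl ⟨K, m, g₀⟩) ∧ S.cpl ⟨K, m, g₀⟩ K = g ∧
        Step.Discrete031 (β * Real.log S.L) (β' * Real.log S.L) K g (S.cpl ⟨K, m, g₀⟩))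
    (hL1 : 1 < S.L) {γU M θ C : ℝ} {Λ : ℕ → ℕ → ℝ} (hγU : 0 < γU) (hθ0 : 0 < θ) (hθ1 : θ < 1) (hC : 0 ≤ C)
    (hrg : ∀ P : B12.RunParams, Step.InInterval γU P.K (S.cpl P) → RGEqH P.K S.β (S.cpl P))
    (hub : BetaUpperH M γU S.β) (hHL : HistLipschitz Λ γU S.β) (hΛ : FadingMemory C θ Λ) :
    ∃ x₁ s : ℝ, 0 < x₁ ∧ x₁ ≤ γU ∧ 0 < s ∧ BetaAvgAFH s 0 x₁ S.β ∧ BetaLowerH s x₁ S.β := by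
  have hlog : 0 < Real.log (S.L : ℝ) := Real.log_pos (by exact_mod_cast hL1)
  have h1θ : 0 < 1 - θ := by linarith
  obtain ⟨x₁, β, β', hx₁, hx₁U, hβ, -, h⟩ := letters_of_uniformTheorem2_fadingMemory hD hTu 0 hL1 hγU hθ0 hθ1 hC hrg hub hHL hΛ
  have hb : 0 < β * Real.log S.L := mul_pos hβ hlog
  set δ : ℝ := min x₁ (β * Real.log S.L * (1 - θ) / (2 * (C + 1))) with hδ
  have hδpos : 0 < δ := lt_min hx₁ (by positivity)
  obtain ⟨hlo, -⟩ := h δ hδpos (min_le_left _ _)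
  have hCδ : C / (1 - θ) * δ < β * Real.log S.L := by
    have h1 : C / (1 - θ) * δ ≤ C / (1 - θ) * (β * Real.log S.L * (1 - θ) / (2 * (C + 1))) :=
      mul_le_mul_of_nonneg_left (min_le_right _ _) (div_nonneg hC h1θ.le)
    have h2 : C / (1 - θ) * (β * Real.log S.L * (1 - θ) / (2 * (C + 1))) = β * Real.log S.L * (C / (2 * (C + 1))) := by
      field_simp
    have h3 : C / (2 * (C + 1)) < 1 := by rw [div_lt_one (by positivity)]; linarith
    have h4 : β * Real.log S.L * (C / (2 * (C + 1))) < β * Real.log S.L * 1 := mul_lt_mul_of_pos_left h3 hb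
    linarith
  exact ⟨δ, β * Real.log S.L - C / (1 - θ) * δ, hδpos, (min_le_left _ _).trans hx₁U, by linarith,
    betaAvgAFH_of_betaLowerH hlo, hlo⟩

/-- **… `StandingHypotheses` FORM, `hrg` DISCHARGED**: standing hypotheses + `Definitions` + `hTu` + (U) `BetaUpperH b′ γ_U` with b′γ_U² < 1 + the moduli ⟹ ∃ x₁ s > 0, `BetaAvgAFH s 0 x₁ S.β`.
[cite: Balaban1987RG1, Thm 2 (0.31) p.259 with (0.20) p.256, Thm 3 p.264 and p.298] -/
theorem betaAvgAFH_of_uniformTheorem2_fadingMemory' (hH : StandingHypotheses S) (hD : Definitions S)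
    (hTu : ∀ m : ℕ, ∃ γ₀ : ℝ, 0 < γ₀ ∧ ∀ γ : ℝ, 0 < γ → γ ≤ γ₀ → ∃ g₁ : ℝ, 0 < g₁ ∧ ∃ β β' : ℝ, 0 < β ∧ β ≤ β' ∧
      ∀ g : ℝ, 0 < g → g ≤ g₁ → ∀ K : ℕ, ∃ g₀ : ℝ, Step.InInterval γ K (S.cpl ⟨K, m, g₀⟩) ∧ S.cpl ⟨K, m, g₀⟩ K = g ∧
        Step.Discrete031 (β * Real.log S.L) (β' * Real.log S.L) K g (S.cpl ⟨K, m, g₀⟩))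
    {γU b' θ C : ℝ} {Λ : ℕ → ℕ → ℝ} (hγU : 0 < γU) (hθ0 : 0 < θ) (hθ1 : θ < 1) (hC : 0 ≤ C)
    (hub : BetaUpperH b' γU S.β) (hsmall : b' * γU ^ 2 < 1) (hHL : HistLipschitz Λ γU S.β) (hΛ : FadingMemory C θ Λ) :
    ∃ x₁ s : ℝ, 0 < x₁ ∧ x₁ ≤ γU ∧ 0 < s ∧ BetaAvgAFH s 0 x₁ S.β := by
  obtain ⟨x₁, s, hx₁, hx₁U, hs, h, -⟩ := betaAvgAFH_of_uniformTheorem2_fadingMemory hD hTu (hL_of_standing hH).2 hγU hθ0 hθ1 hC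
    (hrg_of_betaUpperH hD hγU hub hsmall) hub hHL hΛ
  exact ⟨x₁, s, hx₁, hx₁U, hs, h⟩

/-! ## §2 The two-coupling family violates the averaged carrier at every slope, defect and box -/

section Family

variable {D : ℕ → ℝ → ℝ}
  (hDip : ∀ (k : ℕ) (y : ℝ), D k y = smoothTransition (2 * (y - ((k : ℝ) + 4))) * smoothTransition (2 * (((k : ℝ) + 4) + 1 - y)))
  (hβ : ∀ (k : ℕ) (p : Fin (k + 1) → ℝ), S.β k p = if p (Fin.last k) = 0 then 1 else
    1 - 3 / 2 * D 0 (1 / (p ⟨k - 1, Nat.lt_succ_of_le (Nat.sub_le k 1)⟩) ^ 2 - 1 / (p (Fin.last k)) ^ 2 + 4))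
include hDip hβ

/-- **NO AVERAGED-AF CARRIER FOR THE TWO-COUPLING FAMILY.**  For every box size γ > 0, every slope s ≥ 0 and every defect Dₑ, `BetaAvgAFH s Dₑ γ S.β` FAILS: the box history g_j = (1∕γ² + (n − j)∕2)^{−1∕2}
(n consecutive increments ½, ending and staying at γ) has β_{j+1}(g₀, …, g_j) = −½ for 1 ≤ j ≤ n (the dip's bottom), so the window sum over [1, n) is −(n − 1)∕2 < −Dₑ ≤ s(n − 1) − Dₑ for n large —
although NO run visits these histories (along runs the increments are 1, part 4a). [cite: Balaban1987RG1, p.298 («depends also on all preceding coupling constants»)] -/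
theorem not_betaAvgAFH_hist {γ : ℝ} (hγ : 0 < γ) {s : ℝ} (hs : 0 ≤ s) (Dₑ : ℝ) : ¬ BetaAvgAFH s Dₑ γ S.β := by
  intro h
  obtain ⟨n, hn⟩ := exists_nat_gt (2 * |Dₑ| + 2)
  have hlev : ∀ j : ℕ, 0 < 1 / γ ^ 2 + ((n - j : ℕ) : ℝ) / 2 := fun j => by positivity
  set g : ℕ → ℝ := fun j => 1 / Real.sqrt (1 / γ ^ 2 + ((n - j : ℕ) : ℝ) / 2) with hg
  have hsq : ∀ j : ℕ, 1 / (g j) ^ 2 = 1 / γ ^ 2 + ((n - j : ℕ) : ℝ) / 2 := fun j => by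
    rw [hg]; dsimp only; rw [div_pow, one_pow, Real.sq_sqrt (hlev j).le, one_div_one_div]
  have hgpos : ∀ j, 0 < g j := fun j => one_div_pos.2 (Real.sqrt_pos.2 (hlev j))
  have hgle : ∀ j, g j ≤ γ := fun j => by
    have h1 : 1 / γ ≤ Real.sqrt (1 / γ ^ 2 + ((n - j : ℕ) : ℝ) / 2) :=
      (Real.le_sqrt' (by positivity)).2 (by rw [div_pow, one_pow]; linarith [(Nat.cast_nonneg (n - j) : (0 : ℝ) ≤ _)])
    exact (one_div_le_one_div_of_le (by positivity) h1).trans_eq (one_div_one_div γ)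
  have hval : ∀ j ∈ Finset.Ico 1 n, S.β j (prefixOf g j) = -(1 / 2) := by
    intro j hj
    obtain ⟨hj1, hjn⟩ := Finset.mem_Ico.1 hj
    rw [hβ]
    have hlast : prefixOf g j (Fin.last j) = g j := rfl
    have hprev : prefixOf g j ⟨j - 1, Nat.lt_succ_of_le (Nat.sub_le j 1)⟩ = g (j - 1) := rfl
    rw [hlast, if_neg (hgpos j).ne', hprev, hsq, hsq]
    have hc : ((n - (j - 1) : ℕ) : ℝ) = ((n - j : ℕ) : ℝ) + 1 := by
      rw [show n - (j - 1) = (n - j) + 1 by omega]; push_cast; ring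
    rw [hc, show (1 : ℝ) / γ ^ 2 + (((n - j : ℕ) : ℝ) + 1) / 2 - (1 / γ ^ 2 + ((n - j : ℕ) : ℝ) / 2) + 4 = ((0 : ℕ) : ℝ) + 4 + 1 / 2 by
      push_cast; ring, dip_center hDip 0]
    norm_num
  have hn2 : (2 : ℝ) * |Dₑ| + 2 < n := hn
  have hn1 : 1 ≤ n := by
    have : (1 : ℝ) ≤ n := by linarith [abs_nonneg Dₑ]
    exact_mod_cast this
  have hsum := h g (fun j => ⟨hgpos j, hgle j⟩) 1 n hn1
  rw [Finset.sum_congr rfl hval, Finset.sum_const, Nat.card_Ico, nsmul_eq_mul, Nat.cast_sub hn1] at hsum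
  push_cast at hsum
  have hsn : 0 ≤ s * ((n : ℝ) - 1) := mul_nonneg hs (by linarith [abs_nonneg Dₑ])
  linarith [le_abs_self Dₑ, abs_nonneg Dₑ]

end Family

/-! ## §3 On settings: socket e3's carrier is NOT forced without the modulus -/

/-- **THE TWO-COUPLING SETTING HAS NO AVERAGED-AF CARRIER AT ALL** — while carrying [I]'s typed content, (0.31) with g-uniform constants, `Theorem2Statement`, uniqueness of the in-interval run
on ]0, ½], (U), (C), p. 264's clause box-wide and `hrg` (part 4b's `histToy_exists`): for every γ > 0, s ≥ 0, Dₑ, ¬`BetaAvgAFH s Dₑ γ S.β`.  With §1: under node U2's moduli the carrier is forced;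
without them it is not, at any slope or defect. [cite: Balaban1987RG1, Thm 2 (0.31) p.259 and p.298] -/
theorem avgAF_loadBearing :
    ∃ (S : Setting) (hH : StandingHypotheses S), Definitions S ∧ Conclusions S ∧ B12BetaAsPrinted S ∧
      (∀ m : ℕ, ∃ γ₀ : ℝ, 0 < γ₀ ∧ ∀ γ : ℝ, 0 < γ → γ ≤ γ₀ → ∃ g₁ : ℝ, 0 < g₁ ∧ ∃ β β' : ℝ, 0 < β ∧ β ≤ β' ∧
        ∀ g : ℝ, 0 < g → g ≤ g₁ → ∀ K : ℕ, ∃ g₀ : ℝ, Step.InInterval γ K (S.cpl ⟨K, m, g₀⟩) ∧ S.cpl ⟨K, m, g₀⟩ K = g ∧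
          Step.Discrete031 (β * Real.log S.L) (β' * Real.log S.L) K g (S.cpl ⟨K, m, g₀⟩)) ∧
      Theorem2Statement S (hL_of_standing hH) ∧
      (∀ (K m : ℕ) (g₀ g₀' : ℝ), Step.InInterval (1 / 2) K (S.cpl ⟨K, m, g₀⟩) → Step.InInterval (1 / 2) K (S.cpl ⟨K, m, g₀'⟩) →
        S.cpl ⟨K, m, g₀⟩ K = S.cpl ⟨K, m, g₀'⟩ K → g₀ = g₀') ∧
      BetaUpperH 1 (1 / 2) S.β ∧ BetaContH (1 / 2) S.β ∧ BetaSmoothInLast264 (1 / 2) S.β ∧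
      (∀ P : B12.RunParams, Step.InInterval (1 / 2) P.K (S.cpl P) → RGEqH P.K S.β (S.cpl P)) ∧
      ∀ (γ s Dₑ : ℝ), 0 < γ → 0 ≤ s → ¬ BetaAvgAFH s Dₑ γ S.β := by
  have hDip : ∀ (k : ℕ) (y : ℝ), (fun (k : ℕ) (y : ℝ) => smoothTransition (2 * (y - ((k : ℝ) + 4))) *
      smoothTransition (2 * (((k : ℝ) + 4) + 1 - y))) k y =
      smoothTransition (2 * (y - ((k : ℝ) + 4))) * smoothTransition (2 * (((k : ℝ) + 4) + 1 - y)) := fun _ _ => rfl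
  obtain ⟨S, hβ, -, -, hH, hD, hC, -⟩ := histToy_exists hDip
  obtain ⟨hU, hCt, hSm, hrg⟩ := letters_hist hDip hβ hD
  obtain ⟨hTu, hT, -⟩ := uniformTheorem2_not_betaSignH_hist hDip hβ hH hD
  exact ⟨S, hH, hD, hC, fun _ _ => hC, hTu, hT, fun K m g₀ g₀' hI hI' hend => unique_hist hDip hβ hD hrg K m g₀ g₀' hI hI' hend,
    hU, hCt, hSm, hrg, fun γ s Dₑ hγ hs => not_betaAvgAFH_hist hDip hβ hγ hs Dₑ⟩

/-- **§1 WITH THE MODULI DELETED IS FALSE AS A SCHEMA** — even keeping uniqueness, even at slope 0 and any defect: «[I]'s typed content + g-uniform (0.31) + uniqueness of in-]0, γ]-interval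
runs + (U) + `hrg` on ]0, γ] ⟹ ∃ box and defect with `BetaAvgAFH 0 Dₑ x₁ S.β`» fails (γ = ½, the two-coupling toy). [cite: Balaban1987RG1, Thm 2 (0.31) p.259 and p.298] -/
theorem not_betaAvgAFH_without_modulus_schema :
    ¬ ∀ (S : Setting) (hH : StandingHypotheses S), Definitions S → Conclusions S →
        (∀ m : ℕ, ∃ γ₀ : ℝ, 0 < γ₀ ∧ ∀ γ : ℝ, 0 < γ → γ ≤ γ₀ → ∃ g₁ : ℝ, 0 < g₁ ∧ ∃ β β' : ℝ, 0 < β ∧ β ≤ β' ∧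
          ∀ g : ℝ, 0 < g → g ≤ g₁ → ∀ K : ℕ, ∃ g₀ : ℝ, Step.InInterval γ K (S.cpl ⟨K, m, g₀⟩) ∧ S.cpl ⟨K, m, g₀⟩ K = g ∧
            Step.Discrete031 (β * Real.log S.L) (β' * Real.log S.L) K g (S.cpl ⟨K, m, g₀⟩)) →
        ∀ γ : ℝ, 0 < γ →
          (∀ (K m : ℕ) (g₀ g₀' : ℝ), Step.InInterval γ K (S.cpl ⟨K, m, g₀⟩) → Step.InInterval γ K (S.cpl ⟨K, m, g₀'⟩) →
            S.cpl ⟨K, m, g₀⟩ K = S.cpl ⟨K, m, g₀'⟩ K → g₀ = g₀') →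
          BetaUpperH 1 γ S.β → (∀ P : B12.RunParams, Step.InInterval γ P.K (S.cpl P) → RGEqH P.K S.β (S.cpl P)) →
          ∃ x₁ Dₑ : ℝ, 0 < x₁ ∧ BetaAvgAFH 0 Dₑ x₁ S.β := by
  intro h
  obtain ⟨S, hH, hD, hC, -, hTu, -, huniq, hU, -, -, hrg, hno⟩ := avgAF_loadBearing
  obtain ⟨x₁, Dₑ, hx₁, hA⟩ := h S hH hD hC hTu (1 / 2) (by norm_num) huniq hU hrg
  exact hno x₁ 0 Dₑ hx₁ le_rfl hA

end

end Summit.QuantumFields.BalabanUV.Beta.EriceFlowEnclosureB12AsPrintedPointwiseFadingAvgAF
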